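import Summits.AtomisticToContinuum.Crystallization.Theorems.PricedLinkCensusStackingHingeWords
import Summits.AtomisticToContinuum.Crystallization.Theorems.PricedLinkCensusSoftLayerPropagationBasics
import Summits.AtomisticToContinuum.Crystallization.Theorems.PricedLinkCensusStackingHingeKinematicCompactness
import Literature.Geometry.DiscreteGeometry.BondGraph
import Literature.MathematicalPhysics.StatisticalMechanics.BarlowStacking

/-!
# `StackingHinge` (stmt-AtomisticToContinuum-14993), line `Sketch`: stub `stub_slpMatchTransfer`

Deterministic metric transfer of the `SoftLayerPropagation` matching.  A site `i` of a finite
configuration `y : Fin N → ℝ³` is matched, at tolerance `nn/6` within radius `3 nn`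
(`nn = nearestDist y i`), two ways, with a rigid image `g Λ` of the Barlow stacking
`Λ = barlowStacking nn (nn √(2/3)) s`; a set `S ∋ 0` is two-way `ε`-close, inside radius
`R ≥ 4 nn + 1`, to the recentred configuration `{y k - y i}`.  Then the root `0` of `S` is matched
at tolerance `nn'/6 + τ` within radius `(3 - σ) nn'`, `nn' = Metric.infDist 0 (S ∖ {0})`, as soon
as `20 ε ≤ σ nn`, `20 ε ≤ τ`, `0 < σ ≤ 1`.

Proof.
* The nearest neighbour `k₀` of `i` has an `ε`-close point `p₀ ∈ S`, `nn - ε ≤ ‖p₀‖ ≤ nn + ε`,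
  so `nn' ≤ nn + ε`.
* DEGENERATE CASE: some `p ∈ S ∖ {0}` has `‖p‖ ≤ ε`.  Then `nn' ≤ ε`, both radii `(3 - σ) nn'`
  are `≤ 3 ε ≤ τ`, and the stacking point `0` resp. the root `0 ∈ S` match everything
  (`transfer_degenerate`).
* MAIN CASE: otherwise every `p ∈ S ∖ {0}` has `‖p‖ ≥ nn - ε` (it is `ε`-close to some
  `y k - y i`, `k ≠ i`), so `|nn' - nn| ≤ ε`.  Re-base the stacking at the point `z₀` matched to
  `y i` (`mem_barlowStacking_iff_sub_mem_shift`: `Λ - z₀` is the stacking of the shifted Hägg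
  word `s(· + m)`) and recentre the rigid motion, `g' w = g (w + z₀) - y i`, so that `‖g' 0‖ ≤ nn/6`
  and the matching reads in the recentred frame (`transfer_clause₁`, `transfer_clause₂`); rescale
  the stacking from `nn` to `nn'` pointwise (`w = nn • x ↦ nn' • x`, `x` in the unit stacking,
  `‖x‖ ≤ 10/3`, displacement `≤ 10 ε/3`).  Tolerances add up to `nn/6 + 13 ε/3 ≤ nn'/6 + τ`.
-/

noncomputable section

namespace Summit.AtomisticToContinuum.Crystallization.Theorems.PricedHcpWindowsSlpMatchTransfer

open Literature.Geometry.DiscreteGeometry Literature.MathematicalPhysics.StatisticalMechanics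
open Summit.AtomisticToContinuum.Crystallization.Theorems.PricedHcpWindowsKinematicCompactness
  (norm_le_dist_add_norm)

/-! ## Elementary metric facts -/

/-- `‖b‖ ≤ dist a b + ‖a‖`. [folklore] -/
theorem norm_le_dist_add_norm' (a b : EuclideanSpace ℝ (Fin 3)) : ‖b‖ ≤ dist a b + ‖a‖ := by
  rw [dist_comm]
  exact norm_le_dist_add_norm b a

/-- For a rigid motion `g`: `‖w‖ = dist (g w) (g 0) ≤ ‖g w‖ + ‖g 0‖`. [folklore] -/
theorem norm_le_of_rigid (g : EuclideanSpace ℝ (Fin 3) ≃ᵃⁱ[ℝ] EuclideanSpace ℝ (Fin 3))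
    (w : EuclideanSpace ℝ (Fin 3)) : ‖w‖ ≤ ‖g w‖ + ‖g 0‖ :=
  calc ‖w‖ = dist w 0 := (dist_zero_right w).symm
    _ = dist (g w) (g 0) := (g.dist_map w 0).symm
    _ ≤ ‖g w‖ + ‖g 0‖ := dist_le_norm_add_norm _ _

/-- **Recentring a rigid motion**: `w ↦ g (w + z₀) - q` is again a rigid motion. [folklore] -/
theorem exists_recentred (g : EuclideanSpace ℝ (Fin 3) ≃ᵃⁱ[ℝ] EuclideanSpace ℝ (Fin 3))
    (z₀ q : EuclideanSpace ℝ (Fin 3)) :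
    ∃ g' : EuclideanSpace ℝ (Fin 3) ≃ᵃⁱ[ℝ] EuclideanSpace ℝ (Fin 3),
      ∀ w, g' w = g (w + z₀) - q :=
  ⟨(AffineIsometryEquiv.vaddConst ℝ z₀).trans
      (g.trans (AffineIsometryEquiv.vaddConst ℝ q).symm), fun _ => rfl⟩

/-- **Rescaling a unit stacking point**: for `‖x‖ ≤ 10/3` and `|nn' - nn| ≤ ε`, the images under
a rigid motion of `nn' • x` and `nn • x` are within `10 ε / 3`. [folklore] -/
theorem dist_smul_smul_le (g : EuclideanSpace ℝ (Fin 3) ≃ᵃⁱ[ℝ] EuclideanSpace ℝ (Fin 3))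
    {x : EuclideanSpace ℝ (Fin 3)} {nn nn' ε : ℝ} (hε : 0 ≤ ε) (hx : ‖x‖ ≤ 10 / 3)
    (hup : nn' ≤ nn + ε) (hlo : nn - ε ≤ nn') :
    dist (g (nn' • x)) (g (nn • x)) ≤ 10 / 3 * ε := by
  rw [g.dist_map, dist_eq_norm, ← sub_smul, norm_smul, Real.norm_eq_abs]
  calc |nn' - nn| * ‖x‖ ≤ ε * (10 / 3) :=
        mul_le_mul (abs_le.2 ⟨by linarith, by linarith⟩) hx (norm_nonneg _) hε
    _ = 10 / 3 * ε := by ring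

/-! ## The degenerate case: a point of `S ∖ {0}` in the `ε`-ball -/

/-- If `nn' ≤ ε` then both radii `(3 - σ) nn'` are `≤ 3 ε ≤ τ` and the trivial matching (any Hägg
word, the identity motion; the stacking point `0`, the root `0 ∈ S`) does it. [folklore] -/
theorem transfer_degenerate {S : Set (EuclideanSpace ℝ (Fin 3))} {σ τ ε nn' : ℝ} (hσ : 0 ≤ σ)
    (hτε : 20 * ε ≤ τ) (hnn'0 : 0 ≤ nn') (hnn'ε : nn' ≤ ε)
    (h0S : (0 : EuclideanSpace ℝ (Fin 3)) ∈ S) :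
    ∃ s : ℤ → ℤ, IsHaggSeq s ∧ ∃ g : EuclideanSpace ℝ (Fin 3) ≃ᵃⁱ[ℝ] EuclideanSpace ℝ (Fin 3),
      (∀ p ∈ S, ‖p‖ ≤ (3 - σ) * nn' →
        ∃ z ∈ barlowStacking nn' (nn' * Real.sqrt (2 / 3)) s, dist p (g z) ≤ nn' / 6 + τ) ∧
      (∀ z ∈ barlowStacking nn' (nn' * Real.sqrt (2 / 3)) s, ‖g z‖ ≤ (3 - σ) * nn' →
        ∃ p ∈ S, dist p (g z) ≤ nn' / 6 + τ) := by
  have h3 : (3 - σ) * nn' ≤ 3 * ε := by nlinarith [mul_nonneg hσ hnn'0]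
  refine ⟨alternatingHagg, isHaggSeq_alternating, AffineIsometryEquiv.refl ℝ _, ?_, ?_⟩
  · intro p _ hp
    refine ⟨0, ⟨0, 0, 0, by simp [barlowPos]⟩, ?_⟩
    simp only [AffineIsometryEquiv.coe_refl, id_eq, dist_zero_right]
    linarith
  · intro z _ hz
    refine ⟨0, h0S, ?_⟩
    simp only [AffineIsometryEquiv.coe_refl, id_eq] at hz ⊢
    rw [dist_zero_left]
    linarith

/-! ## The main case: the two scales agree up to `ε` -/

section Main

variable {N : ℕ} {y : Fin N → EuclideanSpace ℝ (Fin 3)} {q : EuclideanSpace ℝ (Fin 3)}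
  {S : Set (EuclideanSpace ℝ (Fin 3))} {σ τ ε nn nn' : ℝ} {s : ℤ → ℤ}
  {g : EuclideanSpace ℝ (Fin 3) ≃ᵃⁱ[ℝ] EuclideanSpace ℝ (Fin 3)}

/-- **Clause 1 in the recentred frame.**  Data: the recentred motion `g` (`‖g 0‖ ≤ nn/6`), the
closeness `S → {y k - q}` inside radius `3 nn`, and clause 1 of the matching of `{y k - q}` with
`g Λ`, `Λ = barlowStacking nn (nn √(2/3)) s`.  Then every `p ∈ S` with `‖p‖ ≤ (3 - σ) nn'` is
within `nn'/6 + τ` of `g` of a point of the rescaled stacking `barlowStacking nn' (nn' √(2/3)) s`: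
`p` is `ε`-close to some `y k - q`, which is `nn/6`-close to some `g (nn • x)`, `‖x‖ ≤ 10/3`, and
`dist (g (nn' • x)) (g (nn • x)) ≤ 10 ε/3`. [folklore] -/
theorem transfer_clause₁ (hnn : 0 < nn) (hε : 0 ≤ ε) (h20 : 20 * ε ≤ σ * nn) (hσ : 0 ≤ σ)
    (hσ1 : σ ≤ 1) (hτε : 20 * ε ≤ τ) (hup : nn' ≤ nn + ε) (hlo : nn - ε ≤ nn')
    (hg0 : ‖g 0‖ ≤ nn / 6)
    (hA : ∀ p ∈ S, ‖p‖ ≤ 3 * nn → ∃ k : Fin N, dist (y k - q) p ≤ ε)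
    (h1 : ∀ k : Fin N, ‖y k - q‖ ≤ 3 * nn →
      ∃ w ∈ barlowStacking nn (nn * Real.sqrt (2 / 3)) s, dist (y k - q) (g w) ≤ nn / 6) :
    ∀ p ∈ S, ‖p‖ ≤ (3 - σ) * nn' →
      ∃ z ∈ barlowStacking nn' (nn' * Real.sqrt (2 / 3)) s, dist p (g z) ≤ nn' / 6 + τ := by
  have hσnn' : (3 - σ) * nn' ≤ 3 * nn - 17 * ε := by
    have h := mul_le_mul_of_nonneg_left hup (by linarith : (0 : ℝ) ≤ 3 - σ)
    nlinarith [mul_nonneg hσ hε]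
  intro p hpS hp
  obtain ⟨k, hk⟩ := hA p hpS (by linarith)
  have hvk : ‖y k - q‖ ≤ 3 * nn := by
    have := norm_le_dist_add_norm (y k - q) p
    linarith
  obtain ⟨w, hwΛ, hw⟩ := h1 k hvk
  obtain ⟨x, hx, rfl⟩ := exists_eq_smul_of_mem_barlowStacking hwΛ
  refine ⟨nn' • x, smul_mem_barlowStacking hx, ?_⟩
  have hgw : ‖g (nn • x)‖ ≤ nn / 6 + 3 * nn := by
    have := norm_le_dist_add_norm' (y k - q) (g (nn • x))
    linarith
  have hxn : ‖x‖ ≤ 10 / 3 := by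
    have h := norm_le_of_rigid g (nn • x)
    rw [norm_smul, Real.norm_eq_abs, abs_of_pos hnn] at h
    have h' : nn * ‖x‖ ≤ nn * (10 / 3) := by linarith
    exact le_of_mul_le_mul_left h' hnn
  have hd := dist_smul_smul_le g hε hxn hup hlo
  calc dist p (g (nn' • x))
      ≤ dist p (y k - q) + dist (y k - q) (g (nn • x)) + dist (g (nn • x)) (g (nn' • x)) :=
        dist_triangle4 _ _ _ _
    _ ≤ ε + nn / 6 + 10 / 3 * ε := by rw [dist_comm p, dist_comm (g (nn • x))]; linarith
    _ ≤ nn' / 6 + τ := by linarith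

/-- **Clause 2 in the recentred frame.**  Data: the recentred motion `g` (`‖g 0‖ ≤ nn/6`), the
closeness `{y k - q} → S` inside radius `4 nn`, and clause 2 of the matching of `{y k - q}` with
`g Λ`.  Then every point `g (nn' • x)` of the image of the rescaled stacking with
`‖g (nn' • x)‖ ≤ (3 - σ) nn'` is within `nn'/6 + τ` of `S`: `‖x‖ ≤ 10/3`, so `g (nn • x)` is
`10 ε/3`-close, has norm `≤ 3 nn`, hence is `nn/6`-close to some `y j - q`, which is `ε`-close to
`S`. [folklore] -/
theorem transfer_clause₂ (hnn : 0 < nn) (hε : 0 ≤ ε) (h20 : 20 * ε ≤ σ * nn) (hσ : 0 ≤ σ)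
    (hσ1 : σ ≤ 1) (hτε : 20 * ε ≤ τ) (hup : nn' ≤ nn + ε) (hlo : nn - ε ≤ nn')
    (hg0 : ‖g 0‖ ≤ nn / 6)
    (hB : ∀ k : Fin N, ‖y k - q‖ ≤ 4 * nn → ∃ p ∈ S, dist (y k - q) p ≤ ε)
    (h2 : ∀ w ∈ barlowStacking nn (nn * Real.sqrt (2 / 3)) s, ‖g w‖ ≤ 3 * nn →
      ∃ j : Fin N, dist (y j - q) (g w) ≤ nn / 6) :
    ∀ z ∈ barlowStacking nn' (nn' * Real.sqrt (2 / 3)) s, ‖g z‖ ≤ (3 - σ) * nn' →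
      ∃ p ∈ S, dist p (g z) ≤ nn' / 6 + τ := by
  have hσnn' : (3 - σ) * nn' ≤ 3 * nn - 17 * ε := by
    have h := mul_le_mul_of_nonneg_left hup (by linarith : (0 : ℝ) ≤ 3 - σ)
    nlinarith [mul_nonneg hσ hε]
  have hεnn : 20 * ε ≤ nn := by
    have := mul_le_mul_of_nonneg_right hσ1 hnn.le
    linarith
  have hnn' : 0 < nn' := by linarith
  intro z hzΛ hz
  obtain ⟨x, hx, rfl⟩ := exists_eq_smul_of_mem_barlowStacking hzΛ
  have hwΛ : nn • x ∈ barlowStacking nn (nn * Real.sqrt (2 / 3)) s := smul_mem_barlowStacking hx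
  have hxn : ‖x‖ ≤ 10 / 3 := by
    have h := norm_le_of_rigid g (nn' • x)
    rw [norm_smul, Real.norm_eq_abs, abs_of_pos hnn'] at h
    have h' : nn' * ‖x‖ ≤ nn' * (10 / 3) := by linarith
    exact le_of_mul_le_mul_left h' hnn'
  have hd := dist_smul_smul_le g hε hxn hup hlo
  have hgw : ‖g (nn • x)‖ ≤ 3 * nn := by
    have := norm_le_dist_add_norm' (g (nn' • x)) (g (nn • x))
    linarith
  obtain ⟨j, hj⟩ := h2 (nn • x) hwΛ hgw
  have hvj : ‖y j - q‖ ≤ 4 * nn := by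
    have := norm_le_dist_add_norm (y j - q) (g (nn • x))
    linarith
  obtain ⟨p, hpS, hp⟩ := hB j hvj
  refine ⟨p, hpS, ?_⟩
  calc dist p (g (nn' • x))
      ≤ dist p (y j - q) + dist (y j - q) (g (nn • x)) + dist (g (nn • x)) (g (nn' • x)) :=
        dist_triangle4 _ _ _ _
    _ ≤ ε + nn / 6 + 10 / 3 * ε := by rw [dist_comm p, dist_comm (g (nn • x))]; linarith
    _ ≤ nn' / 6 + τ := by linarith

end Main

/-! ## The stub -/

/-- **Stub `stub_slpMatchTransfer` of line `Sketch`** (transfer, part a: deterministic metric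
geometry).  If the site `i` of a finite configuration `y` has the `SoftLayerPropagation` matching
(tolerance `nn_i/6`, radius `3 nn_i`, scale `nn_i = nearestDist y i`, word `s`, rigid motion `g`)
and a set `S ∋ 0` is two-way `ε`-close, inside the ball of radius `R ≥ 4 nn_i + 1`, to the
configuration recentred at `y i`, then the root `0` of `S` is matched at tolerance `nn(S)/6 + τ`
within radius `(3 − σ)·nn(S)`, `nn(S) = Metric.infDist 0 (S ∖ {0})`, provided `20 ε ≤ σ nn_i`,
`20 ε ≤ τ`, `0 < σ ≤ 1`.  See the module docstring for the proof. [folklore] -/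
theorem stub_slpMatchTransfer : ∀ (N : ℕ) (y : Fin N → EuclideanSpace ℝ (Fin 3)) (i : Fin N) (S : Set (EuclideanSpace ℝ (Fin 3))) (σ τ R ε : ℝ), 0 < σ → σ ≤ 1 → 0 < τ → 0 < ε → 20 * ε ≤ σ * Literature.Geometry.DiscreteGeometry.nearestDist y i → 20 * ε ≤ τ → 4 * Literature.Geometry.DiscreteGeometry.nearestDist y i + 1 ≤ R → (∃ s : ℤ → ℤ, Literature.MathematicalPhysics.StatisticalMechanics.IsHaggSeq s ∧ ∃ g : EuclideanSpace ℝ (Fin 3) ≃ᵃⁱ[ℝ] EuclideanSpace ℝ (Fin 3), (∀ j : Fin N, dist (y i) (y j) ≤ 3 * Literature.Geometry.DiscreteGeometry.nearestDist y i → ∃ z ∈ Literature.MathematicalPhysics.StatisticalMechanics.barlowStacking (Literature.Geometry.DiscreteGeometry.nearestDist y i) (Literature.Geometry.DiscreteGeometry.nearestDist y i * Real.sqrt (2 / 3)) s, dist (y j) (g z) ≤ Literature.Geometry.DiscreteGeometry.nearestDist y i / 6) ∧ (∀ z ∈ Literature.MathematicalPhysics.StatisticalMechanics.barlowStacking (Literature.Geometry.DiscreteGeometry.nearestDist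 y i) (Literature.Geometry.DiscreteGeometry.nearestDist y i * Real.sqrt (2 / 3)) s, dist (y i) (g z) ≤ 3 * Literature.Geometry.DiscreteGeometry.nearestDist y i → ∃ j : Fin N, dist (y j) (g z) ≤ Literature.Geometry.DiscreteGeometry.nearestDist y i / 6)) → (0 : EuclideanSpace ℝ (Fin 3)) ∈ S → (∀ p ∈ S, ‖p‖ ≤ R → ∃ k : Fin N, dist (y k - y i) p ≤ ε) ∧ (∀ k : Fin N, ‖y k - y i‖ ≤ R → ∃ p ∈ S, dist (y k - y i) p ≤ ε) → (∃ s : ℤ → ℤ, Literature.MathematicalPhysics.StatisticalMechanics.IsHaggSeq s ∧ ∃ g : EuclideanSpace ℝ (Fin 3) ≃ᵃⁱ[ℝ] EuclideanSpace ℝ (Fin 3), (∀ p ∈ S, ‖p‖ ≤ (3 - σ) * Metric.infDist (0 : EuclideanSpace ℝ (Fin 3)) (S \ {0}) → ∃ z ∈ Literature.MathematicalPhysics.StatisticalMechanics.barlowStacking (Metric.infDist (0 : EuclideanSpace ℝ (Fin 3)) (S \ {0})) (Metric.infDist (0 : EuclideanSpace ℝ (Fin 3)) (S \ {0}) * Real.sqrt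 (2 / 3)) s, dist p (g z) ≤ Metric.infDist (0 : EuclideanSpace ℝ (Fin 3)) (S \ {0}) / 6 + τ) ∧ (∀ z ∈ Literature.MathematicalPhysics.StatisticalMechanics.barlowStacking (Metric.infDist (0 : EuclideanSpace ℝ (Fin 3)) (S \ {0})) (Metric.infDist (0 : EuclideanSpace ℝ (Fin 3)) (S \ {0}) * Real.sqrt (2 / 3)) s, ‖g z‖ ≤ (3 - σ) * Metric.infDist (0 : EuclideanSpace ℝ (Fin 3)) (S \ {0}) → ∃ p ∈ S, dist p (g z) ≤ Metric.infDist (0 : EuclideanSpace ℝ (Fin 3)) (S \ {0}) / 6 + τ)) := by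
  intro N y i S σ τ R ε hσ hσ1 _ hε h20 hτε hR hSLP h0S hclose
  set nn := nearestDist y i with hnn_def
  set nn' := Metric.infDist (0 : EuclideanSpace ℝ (Fin 3)) (S \ {0}) with hnn'_def
  -- the scale `nn` is positive, so `i` has a nearest neighbour `k₀`
  have hεnn : 20 * ε ≤ nn := by
    have := mul_le_mul_of_nonneg_right hσ1 (nearestDist_nonneg y i)
    linarith
  have hnn : 0 < nn := by linarith
  have hki : ∃ k, k ≠ i := by
    by_contra h
    push Not at h
    haveI : IsEmpty {k : Fin N // k ≠ i} := ⟨fun k => k.2 (h k.1)⟩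
    have h0 : nn = 0 := by
      rw [hnn_def, nearestDist_def]
      exact Real.iInf_of_isEmpty _
    linarith
  obtain ⟨k₀, hk₀i, hk₀⟩ := exists_nearestDist_eq_dist y hki
  have hyk₀ : ‖y k₀ - y i‖ = nn := by
    rw [← dist_eq_norm, dist_comm]
    exact hk₀.symm
  -- the point `p₀ ∈ S ∖ {0}` close to `y k₀ - y i`; `nn' ≤ nn + ε`
  obtain ⟨p₀, hp₀S, hp₀⟩ := hclose.2 k₀ (by linarith)
  have hp₀lo : nn - ε ≤ ‖p₀‖ := by
    have := norm_le_dist_add_norm (y k₀ - y i) p₀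
    linarith
  have hp₀hi : ‖p₀‖ ≤ nn + ε := by
    have := norm_le_dist_add_norm' (y k₀ - y i) p₀
    linarith
  have hp₀mem : p₀ ∈ S \ {0} := by
    refine ⟨hp₀S, fun h => ?_⟩
    rw [Set.mem_singleton_iff] at h
    rw [h, norm_zero] at hp₀lo
    linarith
  have hup : nn' ≤ nn + ε :=
    calc nn' ≤ dist 0 p₀ := Metric.infDist_le_dist_of_mem hp₀mem
      _ = ‖p₀‖ := dist_zero_left _
      _ ≤ nn + ε := hp₀hi
  have hnn'0 : 0 ≤ nn' := Metric.infDist_nonneg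
  by_cases hdeg : ∃ p ∈ S, p ≠ 0 ∧ ‖p‖ ≤ ε
  · -- degenerate case: `nn' ≤ ε`
    obtain ⟨p₁, hp₁S, hp₁0, hp₁ε⟩ := hdeg
    have hnn'ε : nn' ≤ ε :=
      calc nn' ≤ dist 0 p₁ := Metric.infDist_le_dist_of_mem ⟨hp₁S, hp₁0⟩
        _ = ‖p₁‖ := dist_zero_left _
        _ ≤ ε := hp₁ε
    exact transfer_degenerate hσ.le hτε hnn'0 hnn'ε h0S
  · -- main case: `nn - ε ≤ nn'`
    push Not at hdeg
    have hlo : nn - ε ≤ nn' := by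
      rw [hnn'_def, Metric.le_infDist ⟨p₀, hp₀mem⟩]
      rintro p ⟨hpS, hp0⟩
      have hp0' : p ≠ 0 := fun h => hp0 (Set.mem_singleton_iff.2 h)
      rw [dist_zero_left]
      by_cases hpR : ‖p‖ ≤ R
      · obtain ⟨k, hk⟩ := hclose.1 p hpS hpR
        by_cases hki' : k = i
        · rw [hki', sub_self, dist_zero_left] at hk
          exact absurd hk (not_le.2 (hdeg p hpS hp0'))
        · have h1 : nn ≤ ‖y k - y i‖ := by
            rw [← dist_eq_norm, dist_comm]
            exact nearestDist_le_dist y hki'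
          have := norm_le_dist_add_norm (y k - y i) p
          linarith
      · push Not at hpR
        linarith
    -- re-base the stacking at the point `z₀` matched to `y i`, recentre the rigid motion
    obtain ⟨s, hs, g, hg1, hg2⟩ := hSLP
    obtain ⟨z₀, hz₀Λ, hz₀⟩ := hg1 i (by rw [dist_self]; linarith)
    obtain ⟨m, i₀, j₀, rfl⟩ := hz₀Λ
    obtain ⟨g', hg'⟩ :=
      exists_recentred g (barlowPos nn (nn * Real.sqrt (2 / 3)) s m i₀ j₀) (y i)
    have hg0 : ‖g' 0‖ ≤ nn / 6 := by
      rw [hg', zero_add, ← dist_eq_norm, dist_comm]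
      exact hz₀
    have hA : ∀ p ∈ S, ‖p‖ ≤ 3 * nn → ∃ k : Fin N, dist (y k - y i) p ≤ ε :=
      fun p hpS hp => hclose.1 p hpS (by linarith)
    have hB : ∀ k : Fin N, ‖y k - y i‖ ≤ 4 * nn → ∃ p ∈ S, dist (y k - y i) p ≤ ε :=
      fun k hk => hclose.2 k (by linarith)
    have h1 : ∀ k : Fin N, ‖y k - y i‖ ≤ 3 * nn →
        ∃ w ∈ barlowStacking nn (nn * Real.sqrt (2 / 3)) (fun n => s (n + m)),
          dist (y k - y i) (g' w) ≤ nn / 6 := by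
      intro k hk
      obtain ⟨z, hzΛ, hz⟩ := hg1 k (by rw [dist_eq_norm, norm_sub_rev]; exact hk)
      refine ⟨z - barlowPos nn (nn * Real.sqrt (2 / 3)) s m i₀ j₀,
        (mem_barlowStacking_iff_sub_mem_shift (m := m) (i₀ := i₀) (j₀ := j₀) z).1 hzΛ, ?_⟩
      rw [hg', sub_add_cancel, dist_sub_right]
      exact hz
    have h2 : ∀ w ∈ barlowStacking nn (nn * Real.sqrt (2 / 3)) (fun n => s (n + m)),
        ‖g' w‖ ≤ 3 * nn → ∃ j : Fin N, dist (y j - y i) (g' w) ≤ nn / 6 := by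
      intro w hwΛ hw
      have hmem : w + barlowPos nn (nn * Real.sqrt (2 / 3)) s m i₀ j₀ ∈
          barlowStacking nn (nn * Real.sqrt (2 / 3)) s :=
        (mem_barlowStacking_iff_sub_mem_shift (m := m) (i₀ := i₀) (j₀ := j₀) _).2
          (by rwa [add_sub_cancel_right])
      rw [hg', ← dist_eq_norm, dist_comm] at hw
      obtain ⟨j, hj⟩ := hg2 _ hmem hw
      exact ⟨j, by rw [hg', dist_sub_right]; exact hj⟩
    exact ⟨fun n => s (n + m), isHaggSeq_shift hs m, g',
      transfer_clause₁ hnn hε.le h20 hσ.le hσ1 hτε hup hlo hg0 hA h1,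
      transfer_clause₂ hnn hε.le h20 hσ.le hσ1 hτε hup hlo hg0 hB h2⟩

end Summit.AtomisticToContinuum.Crystallization.Theorems.PricedHcpWindowsSlpMatchTransfer

end
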